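import Mathlib
import HarnessLib
import Summits.HubbardSuperconductivity.HubbardSuperconductivity.Theorems.KLProgrammeKLRegimeWickBubbleChannelPP

/-!
# Route `KLProgramme` — ENGINE child gen 5 (stmt-HubbardSuperconductivity-19918 `KLRegimeEngineV14`), stub `stub_engine_step_values`,
# conjunct (E2-v9): the two PARTICLE–HOLE channels of the two-line Wick term at the pair labels — one loop sum each
# (E2-WICK-ROADMAP §5 (iii-c) step 2, model half, part 2; cell gate-hubbard-kl, seat p1 g9; sequel to `…WickBubbleChannelPP`)

With `Z = (k′↑+, Q−k′↓+, Q−k↓−, k↑−)` the pair labels of `klWickPairAmplitude`, diagonal lines `contr ℂ Cᵢ = diagContr ℓᵢ` (p499749),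
`c₄ = 4!(βL²)³` and `𝒱₄ = vertexFn … 4`, the two particle–hole channel sums of `kernel_dblFold_bubble_self` (p499804) are:

* §1 selection rules of `kernel 𝒲_n 4` at the particle–hole leg strings: equal-charge line ends die; at the DIRECT vertex `(k′↑+, k↑−)` the
  line ends `ψ̂⁻_{pσ}, ψ̂⁺_{p′σ′}` force `p′ = (ω_p, p⃗ + k − k′)`, `σ′ = σ`; at the CROSSED vertex `(k′↑+, Q−k↓−)` they force
  `n(ω_{p′}) + 1 = n(ω_p)` (frequency transfer `2ω₀ = 2π/β`), `p⃗′ = p⃗ + Q − k − k′`, `(σ,σ′) = (↑,↓)` (conservation laws p495253);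
  `sum_swap_pairs` (exchange of the two summation pairs);
* §2 **`bubbleSum_phDirect_pairLabels`**:
  `B(Z₀Z₃|Z₁Z₂) = −c₄⁻²·Σ_{p,σ} (ℓ₂(p)ℓ₁(p+t) + ℓ₁(p)ℓ₂(p+t))·𝒱₄(𝒲_n)(ψ̂⁻_{pσ}, ψ̂⁺_{p+t,σ}, Z₀, Z₃)·𝒱₄(𝒲_n)(ψ̂⁺_{pσ}, ψ̂⁻_{p+t,σ}, Z₁, Z₂)`,
  `t = (0, k − k′)` — ONE loop sum (both spins) at momentum transfer `k − k′`, zero frequency transfer;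
* §3 **`bubbleSum_phCrossed_pairLabels`**:
  `B(Z₀Z₂|Z₁Z₃) = −c₄⁻²·Σ_p Σ_{p′} [n(p′)+1 = n(p) ∧ p⃗′ = p⃗+Q−k−k′]·(ℓ₂(p)ℓ₁(p′) + ℓ₁(p)ℓ₂(p′))·𝒱₄(ψ̂⁻_{p↑}, ψ̂⁺_{p′↓}, Z₀, Z₂)·𝒱₄(ψ̂⁺_{p↑}, ψ̂⁻_{p′↓}, Z₁, Z₃)`
  — ONE loop sum at transfer `(2ω₀, k + k′ − Q)`, spins forced: the exchange bubble of E2-DRIVE (the Kohn–Luttinger source).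
In both, the two orientation terms of the line reduction merge (exchange of the summation pairs + antisymmetry twice), whence the
SYMMETRISED line-value products.

Proved; no definitions; exact identities only; nothing about sizes or the model's physics is asserted.  The `𝒲₆⊗𝒲₂` term and the assembled
vertex-function identity are the sequel `…WickBubbleChannels`.
-/

noncomputable section

namespace Summit.HubbardSuperconductivity.HubbardSuperconductivity.Theorems.KLRegimeWick

set_option linter.dupNamespace false -- summit = problem name (single-conjunct summit), D-0017

open Literature.MathematicalPhysics.QuantumLattice GrassmannAlgebra Finset Matrix
open Literature.Probability.LatticeModels
open Summit.HubbardSuperconductivity.HubbardSuperconductivity.Theorems.TwoPointAssembly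
open Summit.HubbardSuperconductivity.HubbardSuperconductivity.Theorems.KLProgrammeLegKernels
open Summit.HubbardSuperconductivity.HubbardSuperconductivity.Theorems.KLRegimeSplit

section Model

variable {L M : ℕ} [NeZero L] [NeZero M] (β U μ : ℝ) (K : TrigPolyC4v)

/-! ## §1 Selection rules at the particle–hole leg strings; exchanging the summation pairs -/

/-- **Charge selection at a particle–hole vertex** (external legs `ψ̂⁺, ψ̂⁻`): two line ends of EQUAL charge kill the kernel. -/
theorem kernel_klWickAction_ph_same_charge (n : ℕ) (p p' : FreqMomentum L M) (σ σ' c : Fin 2) (A B : FreqMomentum L M × Fin 2) :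
    kernel ℂ (klWickAction L M β U μ K n) 4 ![((p, σ), c), ((p', σ'), c), (A, 0), (B, 1)] = 0 := by
  refine kernel_klWickAction_eq_zero_of_charge β U μ K n ?_
  fin_cases c <;> simp [Fin.sum_univ_four]

/-- **Selection at the DIRECT particle–hole vertex** `(k′↑+, k↑−)` (both at frequency `ω₀`): the line ends `ψ̂⁻_{pσ}, ψ̂⁺_{p′σ′}` carry the kernel only
if `p′ = (ω_p, p⃗ + k − k′)` and `σ′ = σ`. -/
theorem kernel_klWickAction_phd_eq_zero_of_ne (n : ℕ) (k k' : TorusSite 2 L) (p p' : FreqMomentum L M) (σ σ' : Fin 2)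
    (h : (p', σ') ≠ ((p.1, p.2 + k - k'), σ)) :
    kernel ℂ (klWickAction L M β U μ K n) 4 ![((p, σ), 1), ((p', σ'), 0), (((omega0 M, k'), 0), 0), (((omega0 M, k), 0), 1)] = 0 := by
  by_cases hσ : σ' = σ
  · subst hσ
    by_cases hf : p'.1 = p.1
    · have hm : p'.2 ≠ p.2 + k - k' := fun h2 => h (by rw [show p' = (p.1, p.2 + k - k') from Prod.ext hf h2])
      have : ∃ j : Fin 2, p'.2 j ≠ (p.2 + k - k') j := by
        by_contra hall
        push Not at hall
        exact hm (funext hall)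
      obtain ⟨j, hj⟩ := this
      refine kernel_klWickAction_eq_zero_of_momentum β U μ K n j ?_
      simp only [Fin.sum_univ_four, Matrix.cons_val_zero, Matrix.cons_val_one, Matrix.head_cons, Matrix.cons_val_two, Matrix.tail_cons,
        Matrix.cons_val_three, Fin.isValue, if_true, one_ne_zero, if_false, one_smul, neg_smul]
      intro h0
      apply hj
      rw [Pi.sub_apply, Pi.add_apply]
      linear_combination h0
    · refine kernel_klWickAction_eq_zero_of_freq β U μ K n ?_
      simp only [Fin.sum_univ_four, Matrix.cons_val_zero, Matrix.cons_val_one, Matrix.head_cons, Matrix.cons_val_two, Matrix.tail_cons,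
        Matrix.cons_val_three, Fin.isValue, if_true, one_ne_zero, if_false, one_mul, neg_mul, matsubaraInt_omega0]
      intro h0
      apply hf
      apply matsubaraInt_injective M
      linarith
  · refine kernel_klWickAction_eq_zero_of_spin β U μ K n ?_
    fin_cases σ <;> fin_cases σ' <;> simp_all [Fin.sum_univ_four]

/-- **Selection at the CROSSED particle–hole vertex** `(k′↑+, Q−k↓−)` (frequencies `ω₀, −ω₀`): the line ends `ψ̂⁻_{pσ}, ψ̂⁺_{p′σ′}` carry the kernel
only if `n(ω_{p′}) + 1 = n(ω_p)`, `p⃗′ = p⃗ + Q − k − k′` and `(σ, σ′) = (↑, ↓)`. -/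
theorem kernel_klWickAction_phx_eq_zero_of_not (n : ℕ) (Q k k' : TorusSite 2 L) (p p' : FreqMomentum L M) (σ σ' : Fin 2)
    (h : ¬(matsubaraInt M p'.1 + 1 = matsubaraInt M p.1 ∧ p'.2 = p.2 + Q - k - k' ∧ σ = 0 ∧ σ' = 1)) :
    kernel ℂ (klWickAction L M β U μ K n) 4
      ![((p, σ), 1), ((p', σ'), 0), (((omega0 M, k'), 0), 0), ((((omega0 M).rev, Q - k), 1), 1)] = 0 := by
  by_cases hs : σ = 0 ∧ σ' = 1
  · obtain ⟨rfl, rfl⟩ := hs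
    by_cases hf : matsubaraInt M p'.1 + 1 = matsubaraInt M p.1
    · have hm : p'.2 ≠ p.2 + Q - k - k' := fun h2 => h ⟨hf, h2, rfl, rfl⟩
      have : ∃ j : Fin 2, p'.2 j ≠ (p.2 + Q - k - k') j := by
        by_contra hall
        push Not at hall
        exact hm (funext hall)
      obtain ⟨j, hj⟩ := this
      refine kernel_klWickAction_eq_zero_of_momentum β U μ K n j ?_
      simp only [Fin.sum_univ_four, Matrix.cons_val_zero, Matrix.cons_val_one, Matrix.head_cons, Matrix.cons_val_two, Matrix.tail_cons,
        Matrix.cons_val_three, Fin.isValue, if_true, one_ne_zero, if_false, one_smul, neg_smul, Pi.sub_apply]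
      intro h0
      apply hj
      rw [Pi.sub_apply, Pi.sub_apply, Pi.add_apply]
      linear_combination h0
    · refine kernel_klWickAction_eq_zero_of_freq β U μ K n ?_
      simp only [Fin.sum_univ_four, Matrix.cons_val_zero, Matrix.cons_val_one, Matrix.head_cons, Matrix.cons_val_two, Matrix.tail_cons,
        Matrix.cons_val_three, Fin.isValue, if_true, one_ne_zero, if_false, one_mul, neg_mul, matsubaraInt_omega0, matsubaraInt_rev]
      intro h0
      apply hf
      linarith
  · refine kernel_klWickAction_eq_zero_of_spin β U μ K n ?_
    fin_cases σ <;> fin_cases σ' <;> simp_all [Fin.sum_univ_four]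

omit [NeZero L] [NeZero M] in
/-- Exchanging the two (momentum, spin) summation pairs of a quadruple sum. -/
theorem sum_swap_pairs {γ : Type*} [AddCommMonoid γ] (g : FreqMomentum L M → Fin 2 → FreqMomentum L M → Fin 2 → γ) [NeZero L] :
    ∑ p, ∑ σ, ∑ p', ∑ σ', g p σ p' σ' = ∑ p, ∑ σ, ∑ p', ∑ σ', g p' σ' p σ := by
  calc ∑ p, ∑ σ, ∑ p', ∑ σ', g p σ p' σ' = ∑ p, ∑ p', ∑ σ, ∑ σ', g p σ p' σ' :=
        Finset.sum_congr rfl fun p _ => Finset.sum_comm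
    _ = ∑ p', ∑ p, ∑ σ, ∑ σ', g p σ p' σ' := Finset.sum_comm
    _ = ∑ p', ∑ p, ∑ σ', ∑ σ, g p σ p' σ' := Finset.sum_congr rfl fun p' _ => Finset.sum_congr rfl fun p _ => Finset.sum_comm
    _ = ∑ p', ∑ σ', ∑ p, ∑ σ, g p σ p' σ' := Finset.sum_congr rfl fun p' _ => Finset.sum_comm

/-! ## §2 The direct particle–hole channel at the pair labels -/

/-- **`bubbleSum_phDirect_pairLabels`** — the direct particle–hole channel sum of `kernel_dblFold_bubble_self` at the pair labels (`a`-legs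
`Z₀ = k′↑+`, `Z₃ = k↑−`; `b`-legs `Z₁ = Q−k′↓+`, `Z₂ = Q−k↓−`), for diagonal lines: ONE loop sum over `(p, σ)`, the second line at
`p + t`, `t = (0, k − k′)` (same frequency, same spin),
`= −c₄⁻²·Σ_{p,σ} (ℓ₂(p)ℓ₁(p+t) + ℓ₁(p)ℓ₂(p+t))·𝒱₄(𝒲_n)(ψ̂⁻_{pσ}, ψ̂⁺_{p+t,σ}, Z₀, Z₃)·𝒱₄(𝒲_n)(ψ̂⁺_{pσ}, ψ̂⁻_{p+t,σ}, Z₁, Z₂)`. -/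
theorem bubbleSum_phDirect_pairLabels (hβ : β ≠ 0) {C₁ C₂ : Matrix (HubbardFieldIdx L M) (HubbardFieldIdx L M) ℂ}
    {ℓ₁ ℓ₂ : FreqMomentum L M → ℂ} (h₁ : contr ℂ C₁ = diagContr L M ℓ₁) (h₂ : contr ℂ C₂ = diagContr L M ℓ₂) (n : ℕ) (Q k k' : TorusSite 2 L) :
    ∑ X, ∑ Y, ∑ X', ∑ Y', contr ℂ C₂ X Y * contr ℂ C₁ X' Y' *
        (kernel ℂ (klWickAction L M β U μ K n) 4 ![X, X', (((omega0 M, k'), 0), 0), (((omega0 M, k), 0), 1)] *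
          kernel ℂ (klWickAction L M β U μ K n) 4 ![Y, Y', ((((omega0 M).rev, Q - k'), 1), 0), ((((omega0 M).rev, Q - k), 1), 1)]) =
      -((((Nat.factorial 4 : ℝ) * (β * (L : ℝ) ^ 2) ^ 3 : ℝ) : ℂ)⁻¹ ^ 2 *
        ∑ p : FreqMomentum L M, ∑ σ : Fin 2,
          (ℓ₂ p * ℓ₁ (p.1, p.2 + k - k') + ℓ₁ p * ℓ₂ (p.1, p.2 + k - k')) *
            (vertexFn L M β (klWickAction L M β U μ K n) 4
                ![((p, σ), 1), (((p.1, p.2 + k - k'), σ), 0), (((omega0 M, k'), 0), 0), (((omega0 M, k), 0), 1)] *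
              vertexFn L M β (klWickAction L M β U μ K n) 4
                ![((p, σ), 0), (((p.1, p.2 + k - k'), σ), 1), ((((omega0 M).rev, Q - k'), 1), 0), ((((omega0 M).rev, Q - k), 1), 1)])) := by
  set W := klWickAction L M β U μ K n with hW
  set Z₀ : HubbardFieldIdx L M := (((omega0 M, k'), 0), 0) with hZ₀
  set Z₃ : HubbardFieldIdx L M := (((omega0 M, k), 0), 1) with hZ₃
  set Z₁ : HubbardFieldIdx L M := ((((omega0 M).rev, Q - k'), 1), 0) with hZ₁
  set Z₂ : HubbardFieldIdx L M := ((((omega0 M).rev, Q - k), 1), 1) with hZ₂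
  -- Step 1: line reductions
  rw [h₁, h₂]
  simp_rw [mul_assoc, ← Finset.mul_sum]
  rw [sum_diagContr_mul]
  simp_rw [sum_diagContr_mul]
  -- Step 2: charge conservation at the `a`-vertex (legs `ψ̂⁺ψ̂⁻`): equal-charge line ends die
  have hv : ∀ (p p' : FreqMomentum L M) (σ σ' c : Fin 2), kernel ℂ W 4 ![((p, σ), c), ((p', σ'), c), Z₀, Z₃] = 0 :=
    fun p p' σ σ' c => kernel_klWickAction_ph_same_charge β U μ K n p p' σ σ' c _ _
  simp only [hv, zero_mul, sub_zero, zero_sub, mul_neg, Finset.sum_neg_distrib, Finset.mul_sum]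
  -- Step 3: the two orientation terms merge (exchange the summation pairs, antisymmetry twice)
  have hB : ∑ p : FreqMomentum L M, ∑ σ : Fin 2, ∑ p' : FreqMomentum L M, ∑ σ' : Fin 2, ℓ₂ p * (ℓ₁ p' *
        (kernel ℂ W 4 ![((p, σ), 0), ((p', σ'), 1), Z₀, Z₃] * kernel ℂ W 4 ![((p, σ), 1), ((p', σ'), 0), Z₁, Z₂])) =
      ∑ p : FreqMomentum L M, ∑ σ : Fin 2, ∑ p' : FreqMomentum L M, ∑ σ' : Fin 2, ℓ₂ p' * (ℓ₁ p *
        (kernel ℂ W 4 ![((p, σ), 1), ((p', σ'), 0), Z₀, Z₃] * kernel ℂ W 4 ![((p, σ), 0), ((p', σ'), 1), Z₁, Z₂])) := by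
    rw [sum_swap_pairs]
    refine Finset.sum_congr rfl fun p _ => Finset.sum_congr rfl fun σ _ => Finset.sum_congr rfl fun p' _ =>
      Finset.sum_congr rfl fun σ' _ => ?_
    rw [kernel_four_swap01 W ((p, σ), 1) ((p', σ'), 0), kernel_four_swap01 W ((p, σ), 0) ((p', σ'), 1)]
    ring
  -- Step 4: conservation at the `a`-vertex fixes `(p′, σ′) = (p + t, σ)`
  have hcons : ∀ (p : FreqMomentum L M) (σ : Fin 2) (g : FreqMomentum L M → FreqMomentum L M → ℂ),
      ∑ p' : FreqMomentum L M, ∑ σ' : Fin 2, g p p' *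
        (kernel ℂ W 4 ![((p, σ), 1), ((p', σ'), 0), Z₀, Z₃] * kernel ℂ W 4 ![((p, σ), 0), ((p', σ'), 1), Z₁, Z₂]) =
      g p (p.1, p.2 + k - k') * (kernel ℂ W 4 ![((p, σ), 1), (((p.1, p.2 + k - k'), σ), 0), Z₀, Z₃] *
        kernel ℂ W 4 ![((p, σ), 0), (((p.1, p.2 + k - k'), σ), 1), Z₁, Z₂]) := by
    intro p σ g
    rw [← Fintype.sum_prod_type']
    refine Finset.sum_eq_single (((p.1, p.2 + k - k'), σ) : FreqMomentum L M × Fin 2) (fun q _ hq => ?_)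
      (fun h => absurd (Finset.mem_univ _) h)
    obtain ⟨p', σ'⟩ := q
    dsimp only
    rw [kernel_klWickAction_phd_eq_zero_of_ne β U μ K n k k' p p' σ σ' hq, zero_mul, mul_zero]
  have hmerge : ∀ (p : FreqMomentum L M) (σ : Fin 2),
      -(∑ p' : FreqMomentum L M, ∑ σ' : Fin 2, ℓ₂ p * (ℓ₁ p' *
          (kernel ℂ W 4 ![((p, σ), 1), ((p', σ'), 0), Z₀, Z₃] * kernel ℂ W 4 ![((p, σ), 0), ((p', σ'), 1), Z₁, Z₂]))) -
        ∑ p' : FreqMomentum L M, ∑ σ' : Fin 2, ℓ₂ p' * (ℓ₁ p *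
          (kernel ℂ W 4 ![((p, σ), 1), ((p', σ'), 0), Z₀, Z₃] * kernel ℂ W 4 ![((p, σ), 0), ((p', σ'), 1), Z₁, Z₂])) =
      -((ℓ₂ p * ℓ₁ (p.1, p.2 + k - k') + ℓ₁ p * ℓ₂ (p.1, p.2 + k - k')) *
        (kernel ℂ W 4 ![((p, σ), 1), (((p.1, p.2 + k - k'), σ), 0), Z₀, Z₃] *
          kernel ℂ W 4 ![((p, σ), 0), (((p.1, p.2 + k - k'), σ), 1), Z₁, Z₂])) := by
    intro p σ
    rw [← neg_add', ← Finset.sum_add_distrib, ← hcons p σ (fun p p' => ℓ₂ p * ℓ₁ p' + ℓ₁ p * ℓ₂ p')]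
    congr 1
    refine Finset.sum_congr rfl fun p' _ => ?_
    rw [← Finset.sum_add_distrib]
    refine Finset.sum_congr rfl fun σ' _ => ?_
    ring
  -- assemble
  have hL : ∑ p : FreqMomentum L M, ∑ σ : Fin 2, ℓ₂ p *
        (-(∑ p' : FreqMomentum L M, ∑ σ' : Fin 2, ℓ₁ p' *
            (kernel ℂ W 4 ![((p, σ), 1), ((p', σ'), 0), Z₀, Z₃] * kernel ℂ W 4 ![((p, σ), 0), ((p', σ'), 1), Z₁, Z₂])) -
          ∑ p' : FreqMomentum L M, ∑ σ' : Fin 2, ℓ₁ p' *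
            (kernel ℂ W 4 ![((p, σ), 0), ((p', σ'), 1), Z₀, Z₃] * kernel ℂ W 4 ![((p, σ), 1), ((p', σ'), 0), Z₁, Z₂])) =
      ∑ p : FreqMomentum L M, ∑ σ : Fin 2,
        (-(∑ p' : FreqMomentum L M, ∑ σ' : Fin 2, ℓ₂ p * (ℓ₁ p' *
            (kernel ℂ W 4 ![((p, σ), 1), ((p', σ'), 0), Z₀, Z₃] * kernel ℂ W 4 ![((p, σ), 0), ((p', σ'), 1), Z₁, Z₂]))) -
          ∑ p' : FreqMomentum L M, ∑ σ' : Fin 2, ℓ₂ p * (ℓ₁ p' *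
            (kernel ℂ W 4 ![((p, σ), 0), ((p', σ'), 1), Z₀, Z₃] * kernel ℂ W 4 ![((p, σ), 1), ((p', σ'), 0), Z₁, Z₂]))) := by
    refine Finset.sum_congr rfl fun p _ => Finset.sum_congr rfl fun σ _ => ?_
    rw [mul_sub, mul_neg, Finset.mul_sum, Finset.mul_sum]
    simp only [Finset.mul_sum]
  have hsplit : ∑ p : FreqMomentum L M, ∑ σ : Fin 2,
        (-(∑ p' : FreqMomentum L M, ∑ σ' : Fin 2, ℓ₂ p * (ℓ₁ p' *
            (kernel ℂ W 4 ![((p, σ), 1), ((p', σ'), 0), Z₀, Z₃] * kernel ℂ W 4 ![((p, σ), 0), ((p', σ'), 1), Z₁, Z₂]))) -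
          ∑ p' : FreqMomentum L M, ∑ σ' : Fin 2, ℓ₂ p * (ℓ₁ p' *
            (kernel ℂ W 4 ![((p, σ), 0), ((p', σ'), 1), Z₀, Z₃] * kernel ℂ W 4 ![((p, σ), 1), ((p', σ'), 0), Z₁, Z₂]))) =
      -(∑ p : FreqMomentum L M, ∑ σ : Fin 2, ∑ p' : FreqMomentum L M, ∑ σ' : Fin 2, ℓ₂ p * (ℓ₁ p' *
            (kernel ℂ W 4 ![((p, σ), 1), ((p', σ'), 0), Z₀, Z₃] * kernel ℂ W 4 ![((p, σ), 0), ((p', σ'), 1), Z₁, Z₂]))) -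
        ∑ p : FreqMomentum L M, ∑ σ : Fin 2, ∑ p' : FreqMomentum L M, ∑ σ' : Fin 2, ℓ₂ p * (ℓ₁ p' *
            (kernel ℂ W 4 ![((p, σ), 0), ((p', σ'), 1), Z₀, Z₃] * kernel ℂ W 4 ![((p, σ), 1), ((p', σ'), 0), Z₁, Z₂])) := by
    rw [← neg_add', ← Finset.sum_add_distrib, ← Finset.sum_neg_distrib]
    refine Finset.sum_congr rfl fun p _ => ?_
    rw [← Finset.sum_add_distrib, ← Finset.sum_neg_distrib]
    refine Finset.sum_congr rfl fun σ _ => ?_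
    rw [neg_add']
  rw [hL, hsplit, hB]
  conv_rhs => rw [← Finset.sum_neg_distrib]
  rw [← Finset.sum_neg_distrib, ← Finset.sum_sub_distrib]
  refine Finset.sum_congr rfl fun p _ => ?_
  conv_rhs => rw [← Finset.sum_neg_distrib]
  rw [← Finset.sum_neg_distrib, ← Finset.sum_sub_distrib]
  refine Finset.sum_congr rfl fun σ _ => ?_
  rw [hmerge p σ, kernel_four_eq_inv_mul_vertexFn β hβ W, kernel_four_eq_inv_mul_vertexFn β hβ W]
  ring

/-! ## §3 The crossed particle–hole channel at the pair labels -/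

/-- **`bubbleSum_phCrossed_pairLabels`** — the crossed particle–hole channel sum of `kernel_dblFold_bubble_self` at the pair labels (`a`-legs
`Z₀ = k′↑+`, `Z₂ = Q−k↓−`; `b`-legs `Z₁ = Q−k′↓+`, `Z₃ = k↑−`), for diagonal lines: ONE loop sum over `p` (spin `↑` on the `ψ̂⁻_{p}` end forced),
the second line at `p′ = (ω_p − 2ω₀, p⃗ + Q − k − k′)` with spin `↓` — written as the sum over `p′` restricted by the conservation condition
`n(ω_{p′}) + 1 = n(ω_p) ∧ p⃗′ = p⃗ + Q − k − k′` (empty at the lowest frequency index: the finite-`M` edge):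
`= −c₄⁻²·Σ_p Σ_{p′} [cond]·(ℓ₂(p)ℓ₁(p′) + ℓ₁(p)ℓ₂(p′))·𝒱₄(𝒲_n)(ψ̂⁻_{p↑}, ψ̂⁺_{p′↓}, Z₀, Z₂)·𝒱₄(𝒲_n)(ψ̂⁺_{p↑}, ψ̂⁻_{p′↓}, Z₁, Z₃)`
— the exchange bubble at transfer `k + k′ − Q` (E2-DRIVE's Kohn–Luttinger source). -/
theorem bubbleSum_phCrossed_pairLabels (hβ : β ≠ 0) {C₁ C₂ : Matrix (HubbardFieldIdx L M) (HubbardFieldIdx L M) ℂ}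
    {ℓ₁ ℓ₂ : FreqMomentum L M → ℂ} (h₁ : contr ℂ C₁ = diagContr L M ℓ₁) (h₂ : contr ℂ C₂ = diagContr L M ℓ₂) (n : ℕ) (Q k k' : TorusSite 2 L) :
    ∑ X, ∑ Y, ∑ X', ∑ Y', contr ℂ C₂ X Y * contr ℂ C₁ X' Y' *
        (kernel ℂ (klWickAction L M β U μ K n) 4 ![X, X', (((omega0 M, k'), 0), 0), ((((omega0 M).rev, Q - k), 1), 1)] *
          kernel ℂ (klWickAction L M β U μ K n) 4 ![Y, Y', ((((omega0 M).rev, Q - k'), 1), 0), (((omega0 M, k), 0), 1)]) =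
      -((((Nat.factorial 4 : ℝ) * (β * (L : ℝ) ^ 2) ^ 3 : ℝ) : ℂ)⁻¹ ^ 2 *
        ∑ p : FreqMomentum L M, ∑ p' : FreqMomentum L M,
          if matsubaraInt M p'.1 + 1 = matsubaraInt M p.1 ∧ p'.2 = p.2 + Q - k - k' then
            (ℓ₂ p * ℓ₁ p' + ℓ₁ p * ℓ₂ p') *
              (vertexFn L M β (klWickAction L M β U μ K n) 4
                  ![((p, 0), 1), ((p', 1), 0), (((omega0 M, k'), 0), 0), ((((omega0 M).rev, Q - k), 1), 1)] *
                vertexFn L M β (klWickAction L M β U μ K n) 4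
                  ![((p, 0), 0), ((p', 1), 1), ((((omega0 M).rev, Q - k'), 1), 0), (((omega0 M, k), 0), 1)])
          else 0) := by
  set W := klWickAction L M β U μ K n with hW
  set Z₀ : HubbardFieldIdx L M := (((omega0 M, k'), 0), 0) with hZ₀
  set Z₂ : HubbardFieldIdx L M := ((((omega0 M).rev, Q - k), 1), 1) with hZ₂
  set Z₁ : HubbardFieldIdx L M := ((((omega0 M).rev, Q - k'), 1), 0) with hZ₁
  set Z₃ : HubbardFieldIdx L M := (((omega0 M, k), 0), 1) with hZ₃
  -- Step 1: line reductions
  rw [h₁, h₂]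
  simp_rw [mul_assoc, ← Finset.mul_sum]
  rw [sum_diagContr_mul]
  simp_rw [sum_diagContr_mul]
  -- Step 2: charge conservation at the `a`-vertex (legs `ψ̂⁺ψ̂⁻`)
  have hv : ∀ (p p' : FreqMomentum L M) (σ σ' c : Fin 2), kernel ℂ W 4 ![((p, σ), c), ((p', σ'), c), Z₀, Z₂] = 0 :=
    fun p p' σ σ' c => kernel_klWickAction_ph_same_charge β U μ K n p p' σ σ' c _ _
  simp only [hv, zero_mul, sub_zero, zero_sub, mul_neg, Finset.sum_neg_distrib, Finset.mul_sum]
  -- Step 3: merge the two orientation terms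
  have hB : ∑ p : FreqMomentum L M, ∑ σ : Fin 2, ∑ p' : FreqMomentum L M, ∑ σ' : Fin 2, ℓ₂ p * (ℓ₁ p' *
        (kernel ℂ W 4 ![((p, σ), 0), ((p', σ'), 1), Z₀, Z₂] * kernel ℂ W 4 ![((p, σ), 1), ((p', σ'), 0), Z₁, Z₃])) =
      ∑ p : FreqMomentum L M, ∑ σ : Fin 2, ∑ p' : FreqMomentum L M, ∑ σ' : Fin 2, ℓ₂ p' * (ℓ₁ p *
        (kernel ℂ W 4 ![((p, σ), 1), ((p', σ'), 0), Z₀, Z₂] * kernel ℂ W 4 ![((p, σ), 0), ((p', σ'), 1), Z₁, Z₃])) := by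
    rw [sum_swap_pairs]
    refine Finset.sum_congr rfl fun p _ => Finset.sum_congr rfl fun σ _ => Finset.sum_congr rfl fun p' _ =>
      Finset.sum_congr rfl fun σ' _ => ?_
    rw [kernel_four_swap01 W ((p, σ), 1) ((p', σ'), 0), kernel_four_swap01 W ((p, σ), 0) ((p', σ'), 1)]
    ring
  -- Step 4: conservation at the `a`-vertex: spins `(↑, ↓)`, frequency lowered by one, momentum shifted by `Q − k − k′`
  have hcons : ∀ (p : FreqMomentum L M) (g : FreqMomentum L M → FreqMomentum L M → ℂ),
      ∑ σ : Fin 2, ∑ p' : FreqMomentum L M, ∑ σ' : Fin 2, g p p' *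
        (kernel ℂ W 4 ![((p, σ), 1), ((p', σ'), 0), Z₀, Z₂] * kernel ℂ W 4 ![((p, σ), 0), ((p', σ'), 1), Z₁, Z₃]) =
      ∑ p' : FreqMomentum L M, if matsubaraInt M p'.1 + 1 = matsubaraInt M p.1 ∧ p'.2 = p.2 + Q - k - k' then
        g p p' * (kernel ℂ W 4 ![((p, 0), 1), ((p', 1), 0), Z₀, Z₂] * kernel ℂ W 4 ![((p, 0), 0), ((p', 1), 1), Z₁, Z₃]) else 0 := by
    intro p g
    have hz : ∀ (p' : FreqMomentum L M) (σ σ' : Fin 2),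
        ¬(matsubaraInt M p'.1 + 1 = matsubaraInt M p.1 ∧ p'.2 = p.2 + Q - k - k' ∧ σ = 0 ∧ σ' = 1) →
          kernel ℂ W 4 ![((p, σ), 1), ((p', σ'), 0), Z₀, Z₂] = 0 :=
      fun p' σ σ' h => kernel_klWickAction_phx_eq_zero_of_not β U μ K n Q k k' p p' σ σ' h
    rw [Finset.sum_comm]
    refine Finset.sum_congr rfl fun p' _ => ?_
    simp only [Fin.sum_univ_two, Fin.isValue]
    rw [hz p' 0 0 (by simp), hz p' 1 0 (by simp), hz p' 1 1 (by simp)]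
    by_cases hc : matsubaraInt M p'.1 + 1 = matsubaraInt M p.1 ∧ p'.2 = p.2 + Q - k - k'
    · rw [if_pos hc]; ring
    · rw [if_neg hc, hz p' 0 1 (fun h => hc ⟨h.1, h.2.1⟩)]; ring
  have hmerge : ∀ p : FreqMomentum L M,
      ∑ σ : Fin 2, (-(∑ p' : FreqMomentum L M, ∑ σ' : Fin 2, ℓ₂ p * (ℓ₁ p' *
          (kernel ℂ W 4 ![((p, σ), 1), ((p', σ'), 0), Z₀, Z₂] * kernel ℂ W 4 ![((p, σ), 0), ((p', σ'), 1), Z₁, Z₃]))) -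
        ∑ p' : FreqMomentum L M, ∑ σ' : Fin 2, ℓ₂ p' * (ℓ₁ p *
          (kernel ℂ W 4 ![((p, σ), 1), ((p', σ'), 0), Z₀, Z₂] * kernel ℂ W 4 ![((p, σ), 0), ((p', σ'), 1), Z₁, Z₃]))) =
      -(∑ p' : FreqMomentum L M, if matsubaraInt M p'.1 + 1 = matsubaraInt M p.1 ∧ p'.2 = p.2 + Q - k - k' then
        (ℓ₂ p * ℓ₁ p' + ℓ₁ p * ℓ₂ p') *
          (kernel ℂ W 4 ![((p, 0), 1), ((p', 1), 0), Z₀, Z₂] * kernel ℂ W 4 ![((p, 0), 0), ((p', 1), 1), Z₁, Z₃]) else 0) := by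
    intro p
    rw [← hcons p (fun p p' => ℓ₂ p * ℓ₁ p' + ℓ₁ p * ℓ₂ p'), ← Finset.sum_neg_distrib]
    refine Finset.sum_congr rfl fun σ _ => ?_
    rw [← neg_add', ← Finset.sum_add_distrib]
    congr 1
    refine Finset.sum_congr rfl fun p' _ => ?_
    rw [← Finset.sum_add_distrib]
    refine Finset.sum_congr rfl fun σ' _ => ?_
    ring
  -- assemble
  have hL : ∑ p : FreqMomentum L M, ∑ σ : Fin 2, ℓ₂ p *
        (-(∑ p' : FreqMomentum L M, ∑ σ' : Fin 2, ℓ₁ p' *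
            (kernel ℂ W 4 ![((p, σ), 1), ((p', σ'), 0), Z₀, Z₂] * kernel ℂ W 4 ![((p, σ), 0), ((p', σ'), 1), Z₁, Z₃])) -
          ∑ p' : FreqMomentum L M, ∑ σ' : Fin 2, ℓ₁ p' *
            (kernel ℂ W 4 ![((p, σ), 0), ((p', σ'), 1), Z₀, Z₂] * kernel ℂ W 4 ![((p, σ), 1), ((p', σ'), 0), Z₁, Z₃])) =
      -(∑ p : FreqMomentum L M, ∑ σ : Fin 2, ∑ p' : FreqMomentum L M, ∑ σ' : Fin 2, ℓ₂ p * (ℓ₁ p' *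
            (kernel ℂ W 4 ![((p, σ), 1), ((p', σ'), 0), Z₀, Z₂] * kernel ℂ W 4 ![((p, σ), 0), ((p', σ'), 1), Z₁, Z₃]))) -
        ∑ p : FreqMomentum L M, ∑ σ : Fin 2, ∑ p' : FreqMomentum L M, ∑ σ' : Fin 2, ℓ₂ p * (ℓ₁ p' *
            (kernel ℂ W 4 ![((p, σ), 0), ((p', σ'), 1), Z₀, Z₂] * kernel ℂ W 4 ![((p, σ), 1), ((p', σ'), 0), Z₁, Z₃])) := by
    rw [← neg_add', ← Finset.sum_add_distrib, ← Finset.sum_neg_distrib]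
    refine Finset.sum_congr rfl fun p _ => ?_
    rw [← Finset.sum_add_distrib, ← Finset.sum_neg_distrib]
    refine Finset.sum_congr rfl fun σ _ => ?_
    rw [neg_add', mul_sub, mul_neg, Finset.mul_sum, Finset.mul_sum]
    simp only [Finset.mul_sum]
  rw [hL, hB]
  conv_rhs => rw [← Finset.sum_neg_distrib]
  rw [← Finset.sum_neg_distrib, ← Finset.sum_sub_distrib]
  refine Finset.sum_congr rfl fun p _ => ?_
  rw [← Finset.sum_neg_distrib, ← Finset.sum_sub_distrib, hmerge p, neg_inj]
  refine Finset.sum_congr rfl fun p' _ => ?_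
  split_ifs
  · rw [kernel_four_eq_inv_mul_vertexFn β hβ W, kernel_four_eq_inv_mul_vertexFn β hβ W]
    ring
  · ring

end Model

end Summit.HubbardSuperconductivity.HubbardSuperconductivity.Theorems.KLRegimeWick

end
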